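import Mathlib.Tactic.LinearCombination
import Literature.ComputerArithmetic.ConnollyHighamMary2021.StochasticRounding
import HarnessLib

/-!
# Xia–Massei–Hochstenbach–Koren 2022: the biased stochastic rounding schemes `SR_ε` and signed-`SR_ε`

HONEST FRAMING: certified error envelopes and provably optimal rounding/accumulation schemes for
low-precision formats under stated cost models; every table by two implementations; no hardware
or vendor claims.

Source. L. Xia, S. Massei, M. E. Hochstenbach, B. Koren, *On the influence of stochastic roundoff
errors and their bias on the convergence of the gradient descent method with low-precision
floating-point computation*, arXiv:2202.12276 (2022) [cite: XiaEtAl2022]. Page / equation numbers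
below are those of the arXiv version (§2.2, pp. 4–6).

What is typed here (verbatim, measure-free, over an arbitrary finite value set `F ⊂ K` of a linear
ordered field with the candidates `⌊x⌋ = roundDown F x`, `⌈x⌉ = roundUp F x` and the exact-SR
up-probability `(x − ⌊x⌋)/(⌈x⌉ − ⌊x⌋)` of [ConnollyHighamMary2021] (`probUp`); a two-point law is
recorded by its expectation functional `f ↦ E f(result)`):
* Def. 2, (1)–(2): `η(x,ε) = 1 − (x−⌊x⌋)/(⌈x⌉−⌊x⌋) − sign(x)ε`, `φ` = clipping to `[0,1]`,
  `p_ε(x) = φ(η(x,ε))`, and `SR_ε(x) = ⌊x⌋` with probability `p_ε(x)`, `⌈x⌉` otherwise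
  (`eta`, `clip01`, `pEps`, `srEpsE`, `srEpsMean`);
* eq. (3): the expected rounding error of `SR_ε`, piecewise in `η` — PROVED (`srEpsMean_sub_eq`);
* Def. 3 and eq. (4): signed-`SR_ε` with `η̂(x,ε,v) = 1 − (x−⌊x⌋)/(⌈x⌉−⌊x⌋) + sign(v)ε`, whose
  expected error in the middle regime is `sign(−v)ε(⌈x⌉−⌊x⌋)` ("always has a sign opposite to that
  of `v`") — PROVED (`etaHat`, `pEpsHat`, `signedSrEpsE`, `signedSrEpsMean_sub_eq`);
* Lemma 1 in absolute form: the expected error of `SR_ε` has the sign of `x` and modulus at most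
  `ε(⌈x⌉−⌊x⌋)` (the source then divides by `x` and uses `⌈x⌉−⌊x⌋ ≤ 2u|x|` to get
  `0 ≤ E δ ≤ 2εu`; the unit-roundoff step is format bookkeeping and is not typed) — PROVED
  (`sign_mul_srEpsMean_sub_nonneg`, `sign_mul_srEpsMean_sub_le`).
All identities hold for every `x : K` thanks to the junk conventions `⌊x⌋ = x` / `⌈x⌉ = x` outside
the hull (then every regime gives error `0`).
NOT typed here: the relative-error model (5)–(6), Algorithm 1 (MATLAB `chop` implementation), §3–4
(convergence of gradient descent under RN / SR / SR_ε, Lemma 8, Theorems 9–13) and §5 (experiments).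
The venture file `LowPrec/SRBiasedEps` identifies `SR_ε` with the limited-randomness operator
`stepQ` of `LowPrec/SRLimitedBits` for the away-probability function `θ ↦ min(1, θ + ε)` and derives
its exact bias, n-step bias envelope, mean-square error and the half-cell optimality criterion.
-/

namespace Literature.ComputerArithmetic.XiaEtAl2022

open Literature.ComputerArithmetic.ConnollyHighamMary2021

variable {K : Type*} [Field K] [LinearOrder K] [IsStrictOrderedRing K]

/-- `sign(x) ∈ {−1, 0, 1}` as a field element. [cite: XiaEtAl2022, Def. 2] -/
def sgn (x : K) : K := if 0 < x then 1 else if x < 0 then -1 else 0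

/-- `φ(y) = 0 (y ≤ 0), y (0 ≤ y ≤ 1), 1 (y ≥ 1)`: clipping to `[0,1]`. [cite: XiaEtAl2022, Def. 2 (1)] -/
def clip01 (y : K) : K := max 0 (min y 1)

/-- `η(x,ε) = 1 − (x − ⌊x⌋)/(⌈x⌉ − ⌊x⌋) − sign(x)·ε`. [cite: XiaEtAl2022, Def. 2 (1)] -/
def eta (F : Finset K) (ε x : K) : K := 1 - probUp F x - sgn x * ε

/-- `p_ε(x) = φ(η(x,ε))`, the probability that `SR_ε(x) = ⌊x⌋`. [cite: XiaEtAl2022, Def. 2 (2)] -/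
def pEps (F : Finset K) (ε x : K) : K := clip01 (eta F ε x)

/-- The law (2) of `SR_ε(x)` as an expectation functional: `E f(SR_ε(x)) = p_ε(x) f(⌊x⌋) +
(1 − p_ε(x)) f(⌈x⌉)`. [cite: XiaEtAl2022, Def. 2 (2)] -/
def srEpsE (F : Finset K) (ε x : K) (f : K → K) : K :=
  pEps F ε x * f (roundDown F x) + (1 - pEps F ε x) * f (roundUp F x)

/-- `E SR_ε(x)`. [cite: XiaEtAl2022, Def. 2 (2)] -/
def srEpsMean (F : Finset K) (ε x : K) : K := srEpsE F ε x fun t => t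

/-- `η̂(x,ε,v) = 1 − (x − ⌊x⌋)/(⌈x⌉ − ⌊x⌋) + sign(v)·ε`. [cite: XiaEtAl2022, Def. 3] -/
def etaHat (F : Finset K) (ε v x : K) : K := 1 - probUp F x + sgn v * ε

/-- `p̂_ε(x) = φ(η̂(x,ε,v))`, the probability that signed-`SR_ε(x) = ⌊x⌋`. [cite: XiaEtAl2022, Def. 3] -/
def pEpsHat (F : Finset K) (ε v x : K) : K := clip01 (etaHat F ε v x)

/-- The law of signed-`SR_ε(x)` as an expectation functional. [cite: XiaEtAl2022, Def. 3] -/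
def signedSrEpsE (F : Finset K) (ε v x : K) (f : K → K) : K :=
  pEpsHat F ε v x * f (roundDown F x) + (1 - pEpsHat F ε v x) * f (roundUp F x)

/-- `E signed-SR_ε(x)`. [cite: XiaEtAl2022, Def. 3] -/
def signedSrEpsMean (F : Finset K) (ε v x : K) : K := signedSrEpsE F ε v x fun t => t

/-! ### Elementary facts about `sign`, `φ` and the exact up-probability -/

omit [IsStrictOrderedRing K] in
/-- [folklore] `sign x = 1` for `x > 0`. -/
private theorem sgn_of_pos {x : K} (h : 0 < x) : sgn x = 1 := by simp [sgn, h]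

omit [IsStrictOrderedRing K] in
/-- [folklore] `sign x = −1` for `x < 0`. -/
private theorem sgn_of_neg {x : K} (h : x < 0) : sgn x = -1 := by
  simp [sgn, h, not_lt.mpr h.le]

omit [IsStrictOrderedRing K] in
/-- [folklore] `sign 0 = 0`. -/
private theorem sgn_zero : sgn (0 : K) = 0 := by simp [sgn]

omit [IsStrictOrderedRing K] in
/-- [folklore] `sign(x)² ∈ {0, 1}`, recorded as `sign x * sign x = if x = 0 then 0 else 1`. -/
private theorem sgn_mul_self (x : K) : sgn x * sgn x = if x = 0 then 0 else 1 := by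
  rcases lt_trichotomy x 0 with h | h | h
  · simp [sgn_of_neg h, h.ne]
  · simp [h, sgn_zero]
  · simp [sgn_of_pos h, h.ne']

/-- [folklore] `φ(y) = 1` for `y > 1`. -/
private theorem clip01_of_one_lt {y : K} (h : 1 < y) : clip01 y = 1 := by
  simp [clip01, min_eq_right h.le]

omit [IsStrictOrderedRing K] in
/-- [folklore] `φ(y) = 0` for `y < 0`. -/
private theorem clip01_of_neg {y : K} (h : y < 0) : clip01 y = 0 := by
  unfold clip01
  exact max_eq_left ((min_le_left _ _).trans h.le)

omit [IsStrictOrderedRing K] in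
/-- [folklore] `φ(y) = y` on `[0,1]`. -/
private theorem clip01_of_mem {y : K} (h0 : 0 ≤ y) (h1 : y ≤ 1) : clip01 y = y := by
  simp [clip01, min_eq_left h1, max_eq_right h0]

omit [IsStrictOrderedRing K] in
/-- [folklore] `(1 − q(x))·(⌈x⌉ − ⌊x⌋) = ⌈x⌉ − x` for the exact up-probability `q` (also when `⌈x⌉ = ⌊x⌋`,
where both sides vanish). -/
private theorem one_sub_probUp_mul (F : Finset K) (x : K) :
    (1 - probUp F x) * (roundUp F x - roundDown F x) = roundUp F x - x := by
  unfold probUp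
  by_cases h : roundUp F x = roundDown F x
  · have hd : roundDown F x = x := eq_of_roundUp_eq_roundDown h
    rw [h, hd, sub_self]; ring
  · have hne : roundUp F x - roundDown F x ≠ 0 := sub_ne_zero.mpr h
    field_simp
    ring

/-- [folklore] `q(x)·(⌈x⌉ − ⌊x⌋) = x − ⌊x⌋`. -/
private theorem probUp_mul (F : Finset K) (x : K) :
    probUp F x * (roundUp F x - roundDown F x) = x - roundDown F x := by
  have := one_sub_probUp_mul F x
  linear_combination -this

/-- [folklore] The mean of a two-point law `⌊x⌋` w.p. `p`, `⌈x⌉` w.p. `1 − p`, minus `x`, in terms of `p − (1 − q)`. -/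
private theorem twoPointMean_sub (F : Finset K) (p x : K) :
    p * roundDown F x + (1 - p) * roundUp F x - x
      = (1 - probUp F x - p) * (roundUp F x - roundDown F x) := by
  have := one_sub_probUp_mul F x
  linear_combination -this

/-! ### Eq. (3): the expected rounding error of `SR_ε` -/

/-- **Eq. (3).** `E SR_ε(x) − x = ⌊x⌋ − x` if `η(x,ε) > 1`; `= ⌈x⌉ − x` if `η(x,ε) < 0`; and
`= sign(x)·ε·(⌈x⌉ − ⌊x⌋)` if `0 ≤ η(x,ε) ≤ 1` — for every `x` and every `ε`.
[cite: XiaEtAl2022, eq. (3)] -/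
theorem srEpsMean_sub_eq (F : Finset K) (ε x : K) :
    srEpsMean F ε x - x =
      if 1 < eta F ε x then roundDown F x - x
      else if eta F ε x < 0 then roundUp F x - x
      else sgn x * ε * (roundUp F x - roundDown F x) := by
  have key := twoPointMean_sub F (pEps F ε x) x
  simp only [srEpsMean, srEpsE] at *
  split_ifs with h1 h2
  · rw [key, pEps, clip01_of_one_lt h1]
    have := probUp_mul F x
    linear_combination -this
  · rw [key, pEps, clip01_of_neg h2]
    have := one_sub_probUp_mul F x
    linear_combination this
  · rw [key, pEps, clip01_of_mem (not_lt.mp h2) (not_lt.mp h1), eta]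
    ring

/-- **Eq. (4).** `E signed-SR_ε(x) − x = ⌊x⌋ − x` if `η̂ > 1`; `= ⌈x⌉ − x` if `η̂ < 0`; and
`= sign(−v)·ε·(⌈x⌉ − ⌊x⌋) = −sign(v)·ε·(⌈x⌉ − ⌊x⌋)` if `0 ≤ η̂ ≤ 1`: in the middle regime the bias has
the sign opposite to `v`. [cite: XiaEtAl2022, eq. (4)] -/
theorem signedSrEpsMean_sub_eq (F : Finset K) (ε v x : K) :
    signedSrEpsMean F ε v x - x =
      if 1 < etaHat F ε v x then roundDown F x - x
      else if etaHat F ε v x < 0 then roundUp F x - x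
      else -sgn v * ε * (roundUp F x - roundDown F x) := by
  have key := twoPointMean_sub F (pEpsHat F ε v x) x
  simp only [signedSrEpsMean, signedSrEpsE] at *
  split_ifs with h1 h2
  · rw [key, pEpsHat, clip01_of_one_lt h1]
    have := probUp_mul F x
    linear_combination -this
  · rw [key, pEpsHat, clip01_of_neg h2]
    have := one_sub_probUp_mul F x
    linear_combination this
  · rw [key, pEpsHat, clip01_of_mem (not_lt.mp h2) (not_lt.mp h1), etaHat]
    ring

/-! ### Lemma 1 (absolute form): the bias of `SR_ε` has the sign of `x` and size `≤ ε(⌈x⌉ − ⌊x⌋)` -/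

/-- The regime `η > 1` forces `x < 0` (and `q(x) < ε`); the regime `η < 0` forces `x > 0`
(and `1 − q(x) < ε`) — for `0 ≤ ε`. [cite: XiaEtAl2022, proof of Lemma 1] -/
theorem eta_regimes (F : Finset K) {ε : K} (hε : 0 ≤ ε) (x : K) :
    (1 < eta F ε x → x < 0 ∧ probUp F x < ε) ∧ (eta F ε x < 0 → 0 < x ∧ 1 - probUp F x < ε) := by
  have h0 := probUp_nonneg F x
  have h1 := probUp_le_one F x
  constructor
  · intro h
    unfold eta at h
    rcases lt_trichotomy x 0 with hx | rfl | hx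
    · refine ⟨hx, ?_⟩
      rw [sgn_of_neg hx] at h; linarith
    · simp only [sgn_zero, zero_mul, sub_zero] at h; linarith
    · rw [sgn_of_pos hx] at h; nlinarith
  · intro h
    unfold eta at h
    rcases lt_trichotomy x 0 with hx | rfl | hx
    · rw [sgn_of_neg hx] at h; nlinarith
    · simp only [sgn_zero, zero_mul, sub_zero] at h; linarith
    · refine ⟨hx, ?_⟩
      rw [sgn_of_pos hx] at h; linarith

/-- **Lemma 1 (sign).** `0 ≤ sign(x)·(E SR_ε(x) − x)`: the bias of `SR_ε` has the sign of its input
(`0 ≤ ε`). [cite: XiaEtAl2022, Lemma 1] -/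
theorem sign_mul_srEpsMean_sub_nonneg (F : Finset K) {ε : K} (hε : 0 ≤ ε) (x : K) :
    0 ≤ sgn x * (srEpsMean F ε x - x) := by
  have hgap : 0 ≤ roundUp F x - roundDown F x := sub_nonneg.mpr (roundDown_le_roundUp F x)
  obtain ⟨r1, r2⟩ := eta_regimes F hε x
  rw [srEpsMean_sub_eq]
  split_ifs with h1 h2
  · rw [sgn_of_neg (r1 h1).1]
    have := roundDown_le F x
    linarith
  · rw [sgn_of_pos (r2 h2).1]
    have := le_roundUp F x
    linarith
  · rw [show sgn x * (sgn x * ε * (roundUp F x - roundDown F x))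
        = (sgn x * sgn x) * (ε * (roundUp F x - roundDown F x)) by ring, sgn_mul_self]
    split_ifs <;> positivity

/-- **Lemma 1 (size).** `sign(x)·(E SR_ε(x) − x) ≤ ε·(⌈x⌉ − ⌊x⌋)` (`0 ≤ ε`); with the sign statement,
`|E SR_ε(x) − x| ≤ ε(⌈x⌉ − ⌊x⌋)`, which the source turns into `0 ≤ E δ ≤ 2εu`.
[cite: XiaEtAl2022, Lemma 1] -/
theorem sign_mul_srEpsMean_sub_le (F : Finset K) {ε : K} (hε : 0 ≤ ε) (x : K) :
    sgn x * (srEpsMean F ε x - x) ≤ ε * (roundUp F x - roundDown F x) := by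
  have hgap : 0 ≤ roundUp F x - roundDown F x := sub_nonneg.mpr (roundDown_le_roundUp F x)
  obtain ⟨r1, r2⟩ := eta_regimes F hε x
  rw [srEpsMean_sub_eq]
  split_ifs with h1 h2
  · obtain ⟨hx, hq⟩ := r1 h1
    rw [sgn_of_neg hx]
    have := probUp_mul F x
    nlinarith
  · obtain ⟨hx, hq⟩ := r2 h2
    rw [sgn_of_pos hx]
    have := one_sub_probUp_mul F x
    nlinarith
  · rw [show sgn x * (sgn x * ε * (roundUp F x - roundDown F x))
        = (sgn x * sgn x) * (ε * (roundUp F x - roundDown F x)) by ring, sgn_mul_self]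
    split_ifs
    · simp; positivity
    · simp

end Literature.ComputerArithmetic.XiaEtAl2022
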